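import Mathlib
import Summits.NavierStokesRegularity.NavierStokesRegularity.Theorems.EulerZoomLiouvillePowerGaugeEulerLiouvilleFluxWindow
import HarnessLib

/-!
# Tools for the stratum «no Euler collapse from an energy-quiescent past»
# (crux `EulerZoomLiouville.PowerGaugeEulerLiouville` = stmt-NavierStokesRegularity-19832, lead's line `birth`)

Two self-contained lemmas used by `…EnergyVanishing.lean` / `…EnergyVanishingEndpoint.lean`:

* `tendsto_setIntegral_far_of_integrableOn` — if `g ∈ L¹(W × ℝ³)` for a measurable time window `W`, then
  `∫_{W × {‖x‖ ≥ k+1}} g → 0` (`k → ∞`); the window version of `tendsto_setIntegral_far` (`…FluxTools.lean`).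
* `lintegral_enorm_sq_le_of_gauge_half` — **at the endpoint `ρ = 1/2` (energy-conserving scaling `α = 3/2`)
  the `A`-gauge ALONE makes every member of Seregin's class FINITE-ENERGY: `∫_{ℝ³} |u(τ)|² ≤ c` for every
  `τ < 0`** (`a^{2ρ−1} sup_{−a²<τ<0} ∫_{B(a)}|u(τ)|² ≤ c` with `2ρ = 1`, monotone union of balls).  So at the
  endpoint the gauged class is a class of ancient finite-energy Euler flows with energy bounded by the gauge
  constant; exactly self-similar endpoint members `u = (−τ)^{-3/5} V((−τ)^{-2/5} y)` have `V ∈ L²`,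
  `‖u(τ)‖₂ = ‖V‖₂` (the `L²` hypothesis of Chae–Shvydkoy 2013 Thm 3.1 is automatic in the class).

WHAT THIS IS NOT: not NS regularity, not the open core; bookkeeping `--supports` stmt-19832. [folklore]
-/


noncomputable section

set_option linter.dupNamespace false

open MeasureTheory Set Filter Topology Metric Function TopologicalSpace
open scoped ENNReal NNReal InnerProductSpace RealInnerProductSpace Laplacian

namespace Summit.NavierStokesRegularity.NavierStokesRegularity.Theorems.PowerGaugeEulerLiouville

open Literature.Analysis Literature.Analysis.FunctionSpaces Literature.Analysis.FluidPDE

/-! ## Far-window integrals vanish -/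

/-- If `g` is integrable on the window `W × ℝ³` (`W ⊆ ℝ` measurable), then
`∫_{W × {‖x‖ ≥ k+1}} g → 0` as `k → ∞` (dominated convergence over the decreasing far regions, whose
intersection is empty; cf. `tendsto_setIntegral_far` for `W = (−∞,b)`). [folklore] -/
theorem tendsto_setIntegral_far_of_integrableOn {g : ℝ × EuclideanSpace ℝ (Fin 3) → ℝ} {W : Set ℝ}
    (hW : MeasurableSet W)
    (hg : IntegrableOn g (W ×ˢ (univ : Set (EuclideanSpace ℝ (Fin 3)))) volume) :
    Tendsto (fun k : ℕ => ∫ z in W ×ˢ {x : EuclideanSpace ℝ (Fin 3) | (k : ℝ) + 1 ≤ ‖x‖}, g z)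
      atTop (𝓝 0) := by
  set s : ℕ → Set (ℝ × EuclideanSpace ℝ (Fin 3)) :=
    fun k => W ×ˢ {x : EuclideanSpace ℝ (Fin 3) | (k : ℝ) + 1 ≤ ‖x‖} with hs
  have hsm : ∀ k, MeasurableSet (s k) := fun k =>
    hW.prod (measurableSet_le measurable_const measurable_norm)
  have hanti : Antitone s := by
    intro j k hjk z hz
    refine ⟨hz.1, ?_⟩
    have h1 : (k : ℝ) + 1 ≤ ‖z.2‖ := hz.2
    have h2 : (j : ℝ) ≤ k := by exact_mod_cast hjk
    show (j : ℝ) + 1 ≤ ‖z.2‖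
    linarith
  have hfi : IntegrableOn g (s 0) volume := hg.mono_set (prod_mono Subset.rfl (subset_univ _))
  have h := Antitone.tendsto_setIntegral hsm hanti hfi
  have hempty : (⋂ k, s k) = ∅ := by
    refine eq_empty_of_forall_notMem fun z hz => ?_
    rw [mem_iInter] at hz
    obtain ⟨k, hk⟩ := exists_nat_gt ‖z.2‖
    have := (hz k).2
    simp only [mem_setOf_eq] at this
    linarith
  rw [hempty, Measure.restrict_empty, integral_zero_measure] at h
  exact h

/-! ## The endpoint `ρ = 1/2`: finite energy -/

/-- **At the endpoint `ρ = 1/2` every member of the class is finite-energy:** the `A`-gauge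
`a^{2ρ} A(a;0) ≤ c` with `2ρ = 1` reads `sup_{−a² < τ < 0} ∫_{B(a)} |u(τ)|² ≤ c` for every `a`, whence
`∫_{ℝ³} |u(τ)|² ≤ c` for EVERY `τ < 0` (monotone convergence in `a`).  At the energy-conserving scaling the
gauged class is a class of ancient finite-energy Euler flows with energy bounded by the gauge constant.
[folklore] -/
theorem lintegral_enorm_sq_le_of_gauge_half
    {u : ℝ → EuclideanSpace ℝ (Fin 3) → EuclideanSpace ℝ (Fin 3)} {c : ℝ≥0}
    (hA : ∀ a : ℝ, 0 < a →
      ENNReal.ofReal (a ^ (2 * (1 / 2 : ℝ))) * cknA a (0 : ℝ × EuclideanSpace ℝ (Fin 3)) u ≤ (c : ℝ≥0∞))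
    {τ : ℝ} (hτ : τ < 0) :
    ∫⁻ x, ‖u τ x‖ₑ ^ 2 ≤ (c : ℝ≥0∞) := by
  have hS := hasScaledLocalEnergyBound_of_gaugeA (ρ := (1 / 2 : ℝ)) hA
  -- on every ball of radius `a > √(−τ)`: `∫_{B(a)} |u(τ)|² ≤ c · a⁰ = c`
  have hball : ∀ a : ℝ, Real.sqrt (-τ) < a → ∫⁻ x in ball (0 : EuclideanSpace ℝ (Fin 3)) a, ‖u τ x‖ₑ ^ 2 ≤
      (c : ℝ≥0∞) := by
    intro a ha
    have ha0 : 0 < a := lt_of_le_of_lt (Real.sqrt_nonneg _) ha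
    have hτa : τ ∈ Ioo (-(a ^ 2)) 0 := by
      refine ⟨?_, hτ⟩
      have h1 : Real.sqrt (-τ) ^ 2 = -τ := Real.sq_sqrt (by linarith)
      nlinarith [Real.sqrt_nonneg (-τ)]
    have h := hS a ha0 τ hτa
    have hexp : (1 : ℝ) - 2 * (1 / 2) = 0 := by norm_num
    rw [hexp, Real.rpow_zero, mul_one, ENNReal.ofReal_coe_nnreal] at h
    exact h
  -- exhaust `ℝ³` by the balls `B(0, √(−τ) + n + 1)`
  have hcov : (⋃ n : ℕ, ball (0 : EuclideanSpace ℝ (Fin 3)) (Real.sqrt (-τ) + (n : ℝ) + 1)) = univ := by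
    refine eq_univ_of_forall fun x => ?_
    obtain ⟨n, hn⟩ := exists_nat_gt (‖x‖ - Real.sqrt (-τ))
    exact mem_iUnion.2 ⟨n, mem_ball_zero_iff.2 (by linarith)⟩
  have hmono : Monotone fun n : ℕ => ball (0 : EuclideanSpace ℝ (Fin 3)) (Real.sqrt (-τ) + (n : ℝ) + 1) := by
    intro m n hmn
    exact ball_subset_ball (by
      have : (m : ℝ) ≤ n := by exact_mod_cast hmn
      linarith)
  have hdir : Directed (· ⊆ ·) fun n : ℕ => ball (0 : EuclideanSpace ℝ (Fin 3)) (Real.sqrt (-τ) + (n : ℝ) + 1) :=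
    hmono.directed_le
  calc ∫⁻ x, ‖u τ x‖ₑ ^ 2
      = ∫⁻ x in (⋃ n : ℕ, ball (0 : EuclideanSpace ℝ (Fin 3)) (Real.sqrt (-τ) + (n : ℝ) + 1)), ‖u τ x‖ₑ ^ 2 := by
        rw [hcov, Measure.restrict_univ]
    _ = ⨆ n : ℕ, ∫⁻ x in ball (0 : EuclideanSpace ℝ (Fin 3)) (Real.sqrt (-τ) + (n : ℝ) + 1), ‖u τ x‖ₑ ^ 2 :=
        setLIntegral_iUnion_of_directed _ hdir
    _ ≤ (c : ℝ≥0∞) := iSup_le fun n => hball _ (by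
        have : (0 : ℝ) ≤ n := Nat.cast_nonneg n
        linarith)

end Summit.NavierStokesRegularity.NavierStokesRegularity.Theorems.PowerGaugeEulerLiouville

end
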